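import Summits.CriticalPhenomena.PercolationContinuityZ3.Theorems.PercNearOneGluingNoHeavyLowerTailKnQuestion8CoefficientwisePendant
import Literature.Probability.Percolation.KozmaNitzanSeparatingTriple
import HarnessLib

/-!
# The off-cluster theorem restricted to events of the frozen cluster — RZ for a pendant conditioning vertex (prim-lf-2 gen 30)

Support file (`--supports stmt-CriticalPhenomena-4575`, closed), prover `prim-lf-2` (gen 30).  No definitions, no named facts, no sorries; standard axioms.
Memo `prim-lf-2/CW-ROOT-gen30.md` (§2 conjecture RZ; D30.8); companion `…CoefficientwiseRootRegrouping.lean` (p261590).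

gen 23's `Coefficientwise.offCluster_twoColouring_nonneg` (`0 ≤ Σ_{s : A ∩ C_x(s) = ∅} Δf Δg`) is proved CELL BY CELL: the event `{A ∩ C_x(s) = ∅}` is the disjoint
union, over the red clusters `S` of the set `A` not containing `x` and the red edge sets inside `S`, of cylinders of the cube on each of which the summand sum is
`≥ 0` (`twoColouring_cell_nonneg_of_le`).  Hence the sum over ANY sub-family of cells is `≥ 0`; a sub-family is exactly an event of the frozen data, in particular
any event `P(R_A(s))` of the red cluster `R_A(s) = ⋃_{a∈A} C_a(s)` of `A`:
* `Coefficientwise.offCluster_twoColouring_nonneg_pred` — `0 ≤ Σ_{s : A ∩ C_x(s) = ∅, P(R_A(s))} (f(C_x s) − f(C_x sᶜ))(g(C_x s) − g(C_x sᶜ))` for every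
  predicate `P : Set V → Prop` and monotone `f, g`.
Use (memo §2/§7): for a pendant conditioning vertex `z ∼ v` the gen-30 restricted kernel `RZ_a(H;A′)` (first-rung summands over `S(H) ∩ {a ∈ C_z^red} ∩
{A′ unjoined to z}`) is, after deleting `z` exactly as in `…CoefficientwisePendant.lean`, the case `A = {v}`, `P(R) = (a ∈ R ∧ R ∩ A′ = ∅)` — so conjecture RZ
holds for pendant `z`.  For non-pendant `z` the cells of `C_z^red` are NOT individually `≥ 0` (already `C₄`, memo D30.8), which is why the general RZ is open.
[cite: KozmaNitzan2024, Questions 8–9 (§5.5 p. 36) (context: first rung of the coefficientwise programme for Question 8)]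
-/

namespace Summit.CriticalPhenomena.PercolationContinuityZ3.Theorems

open Finset Literature.Probability.Percolation

namespace Coefficientwise

variable {ι V : Type*}

section pred
variable [Fintype ι] [DecidableEq ι]

open Classical in
/-- **Off-cluster theorem restricted to any event of the red cluster of `A` (prim-lf-2 gen 30).**  For a finite multigraph (`ends : ι → Sym2 V`), a vertex `x`,
a vertex set `A`, monotone `f, g : Set V → ℝ`, and ANY predicate `P` on vertex sets, with `R_A(s) = ⋃_{a ∈ A} C_a(s)` the red cluster of the set `A`,
  `0 ≤ Σ_{s ⊆ ι : A ∩ C_x(s) = ∅, P(R_A(s))} (f(C_x(s)) − f(C_x(sᶜ)))·(g(C_x(s)) − g(C_x(sᶜ)))`.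
The gen-23 proof of `offCluster_twoColouring_nonneg` (the case `P = ⊤`) is cell-by-cell over the cells of `R_A`, so any union of cells — i.e. any event of the
frozen data `R_A(s)` — inherits positivity.  With `A = {v}` and `P(R) = (a ∈ R ∧ R ∩ A′ = ∅)` this is, for a PENDANT conditioning vertex `z ∼ v`, the
restricted first-rung kernel `RZ_a(H;A′) = Σ_{S(H), a ∈ C_z^red, A′ unjoined} (δ_K − δ_K̄)^{⊗2} ⪰ 0` of memo CW-ROOT-gen30 §2 (conjecture RZ, proved here for pendant `z`;
the general case is open, and its z-cell decomposition fails from `C₄` on — memo D30.8).  [cite: KozmaNitzan2024, Questions 8–9 (§5.5 p. 36) (context)] -/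
theorem offCluster_twoColouring_nonneg_pred (ends : ι → Sym2 V) (x : V) (A : Set V) (P : Set V → Prop) (f g : Set V → ℝ)
    (hf : Monotone f) (hg : Monotone g) :
    0 ≤ ∑ s ∈ univ.filter (fun s : Finset ι => (∀ a ∈ A, a ∉ openCluster (ends '' (↑s : Set ι)) x) ∧
        P {y | ∃ a ∈ A, y ∈ openCluster (ends '' (↑s : Set ι)) a}),
      (f (openCluster (ends '' (↑s : Set ι)) x) - f (openCluster (ends '' (↑(sᶜ) : Set ι)) x)) *
        (g (openCluster (ends '' (↑s : Set ι)) x) - g (openCluster (ends '' (↑(sᶜ) : Set ι)) x)) := by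
  -- notation
  set K : Finset ι → Set V := fun s => openCluster (ends '' (↑s : Set ι)) x with hK
  set F : Finset ι → ℝ := fun s => f (K s) with hF
  set G : Finset ι → ℝ := fun s => g (K s) with hG
  set D : Finset (Finset ι) := univ.filter (fun s : Finset ι => (∀ a ∈ A, a ∉ openCluster (ends '' (↑s : Set ι)) x) ∧
    P {y | ∃ a ∈ A, y ∈ openCluster (ends '' (↑s : Set ι)) a}) with hD
  change 0 ≤ ∑ s ∈ D, (F s - F sᶜ) * (G s - G sᶜ)
  have hKmono : ∀ {s t : Finset ι}, s ⊆ t → K s ⊆ K t := fun hst => openCluster_image_mono ends hst x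
  have hFm : Monotone F := fun s t hst => hf (hKmono hst)
  have hGm : Monotone G := fun s t hst => hg (hKmono hst)
  -- the red cluster of the set `A`, the edges at a vertex set, and the cell key
  set R : Finset ι → Set V := fun s => {y | ∃ a ∈ A, y ∈ openCluster (ends '' (↑s : Set ι)) a} with hR
  set I : Set V → Finset ι := fun S => univ.filter (fun i : ι => ∃ v ∈ S, v ∈ ends i) with hI
  set key : Finset ι → Set V × Finset ι := fun s => (R s, s ∩ I (R s)) with hkey
  -- basic facts about `R`
  have R_closed : ∀ (s : Finset ι) {u w : V}, u ∈ R s → (openGraph (ends '' (↑s : Set ι))).Adj u w → w ∈ R s := by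
    intro s u w hu hadj
    obtain ⟨a, haA, hau⟩ := hu
    exact ⟨a, haA, SimpleGraph.Reachable.trans hau hadj.reachable⟩
  have mem_I : ∀ (S : Set V) (i : ι) (v : V), v ∈ S → v ∈ ends i → i ∈ I S := by
    intro S i v hv hvi
    simp only [hI, Finset.mem_filter, Finset.mem_univ, true_and]
    exact ⟨v, hv, hvi⟩
  have A_sub_R : ∀ (s : Finset ι), ∀ a ∈ A, a ∈ R s := fun s a ha => ⟨a, ha, mem_openCluster_self _ a⟩
  -- (L3) locality: a configuration agreeing with `s₀` on the edges at `R s₀` has the same red cluster of `A`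
  have locality : ∀ s₀ t : Finset ι, t ∩ I (R s₀) = s₀ ∩ I (R s₀) → R t = R s₀ := by
    intro s₀ t ht
    have agree : ∀ i, i ∈ I (R s₀) → (i ∈ t ↔ i ∈ s₀) := by
      intro i hi
      have := congrArg (fun u : Finset ι => i ∈ u) ht
      simp only [Finset.mem_inter, hi, and_true, eq_iff_iff] at this
      exact this
    -- transfer s₀-walks to t-walks inside `R s₀`
    have h1 : ∀ u ∈ R s₀, ∀ w, (openGraph (ends '' (↑s₀ : Set ι))).Adj u w →
        (openGraph (ends '' (↑t : Set ι))).Adj u w ∧ w ∈ R s₀ := by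
      intro u hu w hadj
      refine ⟨?_, R_closed s₀ hu hadj⟩
      rw [openGraph_image_adj] at hadj ⊢
      obtain ⟨⟨i, his, hi⟩, hne⟩ := hadj
      have hiI : i ∈ I (R s₀) := mem_I _ i u hu (by rw [hi]; exact Sym2.mem_mk_left u w)
      exact ⟨⟨i, (agree i hiI).mpr his, hi⟩, hne⟩
    -- transfer t-walks to s₀-walks inside `R s₀`
    have h2 : ∀ u ∈ R s₀, ∀ w, (openGraph (ends '' (↑t : Set ι))).Adj u w →
        (openGraph (ends '' (↑s₀ : Set ι))).Adj u w ∧ w ∈ R s₀ := by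
      intro u hu w hadj
      have hadj' : (openGraph (ends '' (↑s₀ : Set ι))).Adj u w := by
        rw [openGraph_image_adj] at hadj ⊢
        obtain ⟨⟨i, hit, hi⟩, hne⟩ := hadj
        have hiI : i ∈ I (R s₀) := mem_I _ i u hu (by rw [hi]; exact Sym2.mem_mk_left u w)
        exact ⟨⟨i, (agree i hiI).mp hit, hi⟩, hne⟩
      exact ⟨hadj', R_closed s₀ hu hadj'⟩
    ext y
    constructor
    · rintro ⟨a, haA, hay⟩
      obtain ⟨p⟩ := hay
      exact ((reachable_transfer (R s₀) h2 p) (A_sub_R s₀ a haA)).2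
    · rintro ⟨a, haA, hay⟩
      obtain ⟨p⟩ := hay
      exact ⟨a, haA, ((reachable_transfer (R s₀) h1 p) (A_sub_R s₀ a haA)).1⟩
  -- split the sum over `D` along the fibres of `key`
  rw [← Finset.sum_fiberwise_of_maps_to (s := D) (t := D.image key) (g := key)
    (fun s hs => Finset.mem_image_of_mem key hs)]
  refine Finset.sum_nonneg fun k hk => ?_
  obtain ⟨s₀, hs₀D, rfl⟩ := Finset.mem_image.mp hk
  have hs₀ : ∀ a ∈ A, a ∉ K s₀ := by
    have := (Finset.mem_filter.mp hs₀D).2.1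
    simpa [hK] using this
  have hP₀ : P (R s₀) := (Finset.mem_filter.mp hs₀D).2.2
  -- abbreviations for the frozen data of the cell of `s₀`
  set S₀ : Set V := R s₀ with hS₀
  set B : Finset ι := I S₀ with hB
  set π : Finset ι := s₀ ∩ B with hπ
  have hxS₀ : x ∉ S₀ := by
    rintro ⟨a, haA, hax⟩
    exact hs₀ a haA (SimpleGraph.Reachable.symm hax)
  -- (L4) the fibre of `key s₀` in `D` is exactly the cell `{t | t ∩ B = π}`
  have fiber_eq : D.filter (fun t => key t = key s₀) = univ.filter (fun t : Finset ι => t ∩ B = π) := by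
    ext t
    simp only [Finset.mem_filter, Finset.mem_univ, true_and]
    constructor
    · rintro ⟨_, hkt⟩
      have h1 : R t = S₀ := (Prod.ext_iff.mp hkt).1
      have h2 : t ∩ I (R t) = s₀ ∩ I (R s₀) := (Prod.ext_iff.mp hkt).2
      rw [h1] at h2
      exact h2
    · intro ht
      have hRt : R t = S₀ := locality s₀ t ht
      refine ⟨?_, ?_⟩
      · rw [hD, Finset.mem_filter]
        refine ⟨Finset.mem_univ _, fun a haA hax => ?_, ?_⟩
        · have hxRt : x ∈ R t := ⟨a, haA, SimpleGraph.Reachable.symm hax⟩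
          rw [hRt] at hxRt
          exact hxS₀ hxRt
        · change P (R t)
          rw [hRt]; exact hP₀
      · change (R t, t ∩ I (R t)) = (R s₀, s₀ ∩ I (R s₀))
        rw [hRt]
        exact Prod.ext rfl ht
  rw [fiber_eq]
  -- (L5) on the cell, the red cluster of `x` uses no edge at `S₀`
  have offcluster : ∀ t : Finset ι, t ∩ B = π → K t ⊆ K ((B \ π) ∪ (t \ B)) := by
    intro t ht
    have agree : ∀ i, i ∈ B → (i ∈ t ↔ i ∈ s₀) := by
      intro i hi
      have := congrArg (fun u : Finset ι => i ∈ u) ht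
      simp only [hπ, Finset.mem_inter, hi, and_true, eq_iff_iff] at this
      exact this
    have htr : ∀ u ∈ S₀ᶜ, ∀ w, (openGraph (ends '' (↑t : Set ι))).Adj u w →
        (openGraph (ends '' (↑(t \ B) : Set ι))).Adj u w ∧ w ∈ S₀ᶜ := by
      intro u hu w hadj
      rw [openGraph_image_adj] at hadj
      obtain ⟨⟨i, hit, hi⟩, hne⟩ := hadj
      -- the edge `i` is not at `S₀`
      have hiB : i ∉ B := by
        intro hiB
        have his₀ : i ∈ s₀ := (agree i hiB).mp hit
        have hiB' := hiB
        simp only [hB, hI, Finset.mem_filter, Finset.mem_univ, true_and] at hiB'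
        obtain ⟨v, hvS, hvi⟩ := hiB'
        rw [hi, Sym2.mem_iff] at hvi
        rcases hvi with rfl | rfl
        · exact hu hvS
        · -- `w ∈ S₀` and the red edge `i ∈ s₀` joins `w` to `u`, so `u ∈ S₀`
          have hadj₀ : (openGraph (ends '' (↑s₀ : Set ι))).Adj v u := by
            rw [openGraph_image_adj]
            exact ⟨⟨i, his₀, by rw [hi, Sym2.eq_swap]⟩, hne.symm⟩
          exact hu (R_closed s₀ hvS hadj₀)
      have hwS : w ∈ S₀ᶜ := by
        intro hwS
        exact hiB (mem_I S₀ i w hwS (by rw [hi]; exact Sym2.mem_mk_right u w))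
      refine ⟨?_, hwS⟩
      rw [openGraph_image_adj]
      exact ⟨⟨i, Finset.mem_sdiff.mpr ⟨hit, hiB⟩, hi⟩, hne⟩
    intro y hy
    obtain ⟨p⟩ := hy
    have hreach := ((reachable_transfer S₀ᶜ htr p) hxS₀).1
    exact hKmono Finset.subset_union_right hreach
  refine twoColouring_cell_nonneg_of_le B π Finset.inter_subset_right F G hFm hGm ?_ ?_
  · intro t ht; exact hf (offcluster t ht)
  · intro t ht; exact hg (offcluster t ht)


end pred

section transport
variable [DecidableEq ι]

open Classical in
/-- `offCluster_twoColouring_nonneg_pred` on a sub-multigraph with edge set `E'` (colourings `t ⊆ E'`, blue edges `E' ∖ t`), transported along `{i // i ∈ E'}`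
exactly as `offCluster_twoColouring_nonneg_sub`.  [cite: KozmaNitzan2024, Questions 8–9 (§5.5 p. 36) (context)] -/
theorem offCluster_twoColouring_nonneg_pred_sub (ends : ι → Sym2 V) (E' : Finset ι) (x : V) (A : Set V) (P : Set V → Prop) (f g : Set V → ℝ)
    (hf : Monotone f) (hg : Monotone g) :
    0 ≤ ∑ t ∈ E'.powerset.filter (fun t : Finset ι => (∀ a ∈ A, a ∉ openCluster (ends '' (↑t : Set ι)) x) ∧
        P {y | ∃ a ∈ A, y ∈ openCluster (ends '' (↑t : Set ι)) a}),
      (f (openCluster (ends '' (↑t : Set ι)) x) - f (openCluster (ends '' (↑(E' \ t) : Set ι)) x)) *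
        (g (openCluster (ends '' (↑t : Set ι)) x) - g (openCluster (ends '' (↑(E' \ t) : Set ι)) x)) := by
  set emb : {i // i ∈ E'} ↪ ι := Function.Embedding.subtype _ with hemb
  have key := offCluster_twoColouring_nonneg_pred (ends ∘ Subtype.val : {i // i ∈ E'} → Sym2 V) x A P f g hf hg
  have map_compl : ∀ t : Finset {i // i ∈ E'}, (tᶜ).map emb = E' \ t.map emb := by
    intro t
    ext i
    simp only [Finset.mem_map, Finset.mem_compl, Finset.mem_sdiff, hemb, Function.Embedding.coe_subtype]
    constructor
    · rintro ⟨⟨j, hj⟩, hjt, rfl⟩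
      exact ⟨hj, fun ⟨⟨k, hk⟩, hkt, hkj⟩ => hjt (by cases hkj; exact hkt)⟩
    · rintro ⟨hiE, hnot⟩
      exact ⟨⟨i, hiE⟩, fun hit => hnot ⟨⟨i, hiE⟩, hit, rfl⟩, rfl⟩
  have map_sub : ∀ t : Finset {i // i ∈ E'}, t.map emb ⊆ E' := by
    intro t i hi
    obtain ⟨⟨j, hj⟩, _, rfl⟩ := Finset.mem_map.mp hi
    exact hj
  refine key.trans_eq ?_
  refine Finset.sum_bij' (fun t _ => t.map emb) (fun t _ => t.subtype (· ∈ E')) ?_ ?_ ?_ ?_ ?_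
  · intro t ht
    rw [Finset.mem_filter] at ht ⊢
    refine ⟨Finset.mem_powerset.mpr (map_sub t), ?_⟩
    rw [← image_map_subtype]; exact ht.2
  · intro t ht
    rw [Finset.mem_filter] at ht ⊢
    refine ⟨Finset.mem_univ _, ?_⟩
    have hsub : t ⊆ E' := Finset.mem_powerset.mp ht.1
    rw [image_map_subtype, Finset.subtype_map_of_mem (fun i hi => hsub hi)]
    exact ht.2
  · intro t _
    ext ⟨i, hi⟩
    rw [Finset.mem_subtype, Finset.mem_map]
    constructor
    · rintro ⟨⟨j, hj⟩, hjt, hji⟩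
      have hji' : j = i := by simpa [hemb] using hji
      subst hji'
      exact hjt
    · intro h
      exact ⟨⟨i, hi⟩, h, by simp [hemb]⟩
  · intro t ht
    have hsub : t ⊆ E' := Finset.mem_powerset.mp (Finset.mem_filter.mp ht).1
    exact Finset.subtype_map_of_mem (fun i hi => hsub hi)
  · intro t _
    rw [image_map_subtype, image_map_subtype ends E' (tᶜ), map_compl]

omit [DecidableEq ι] in
/-- The red cluster of a leaf `z` (pendant edge `e₀ = {z,v}`): without `e₀` it is `{z}` … [cite: KozmaNitzan2024, §5.5 (context only; folklore)] -/
theorem mem_openCluster_leaf_iff_eq (ends : ι → Sym2 V) {z : V} {e₀ : ι} (hpend : ∀ i, z ∈ ends i → i = e₀)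
    {t : Finset ι} (ht : e₀ ∉ t) (y : V) : y ∈ openCluster (ends '' (↑t : Set ι)) z ↔ y = z := by
  constructor
  · intro hy
    by_contra hyz
    have : z ∈ openCluster (ends '' (↑t : Set ι)) y := SimpleGraph.Reachable.symm hy
    exact leaf_not_mem_openCluster ends hpend (Ne.symm hyz) ht this
  · rintro rfl; exact mem_openCluster_self _ _

/-- … and with `e₀` red it is `{z} ∪ C_v(t)`. [cite: KozmaNitzan2024, §5.5 (context only; folklore)] -/
theorem mem_openCluster_leaf_insert_iff (ends : ι → Sym2 V) {z v : V} {e₀ : ι} (he₀ : ends e₀ = s(z, v))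
    (hpend : ∀ i, z ∈ ends i → i = e₀) {t : Finset ι} (ht : e₀ ∉ t) (y : V) :
    y ∈ openCluster (ends '' (↑(insert e₀ t) : Set ι)) z ↔ y = z ∨ y ∈ openCluster (ends '' (↑t : Set ι)) v := by
  change (openGraph (ends '' (↑(insert e₀ t) : Set ι))).Reachable z y ↔ _
  rw [Finset.coe_insert, Set.image_insert_eq, he₀, KNSep.reachable_insert_iff]
  have hzz : ∀ w, (openGraph (ends '' (↑t : Set ι))).Reachable z w ↔ w = z := fun w =>
    mem_openCluster_leaf_iff_eq ends hpend ht w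
  constructor
  · rintro (h | ⟨_, h⟩ | ⟨h, h'⟩)
    · exact Or.inl ((hzz y).mp h)
    · exact Or.inr h
    · exact Or.inl ((hzz y).mp h')
  · rintro (rfl | h)
    · exact Or.inl (SimpleGraph.Reachable.refl _)
    · exact Or.inr (Or.inl ⟨SimpleGraph.Reachable.refl _, h⟩)

end transport

section pendant
variable [Fintype ι] [DecidableEq ι]

open Classical in
/-- **Conjecture RZ holds for a pendant conditioning vertex** (prim-lf-2 gen 30, memo CW-ROOT-gen30 §2/§7).  Let `z ≠ x` be a leaf (`e₀ = {z,v}` its only edge,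
`z ≠ v`), `a ≠ z` a vertex and `A′ ∌ z` a vertex set.  Then the first-rung kernel of `(E; x, z)` restricted to the `z`-side event
`{a ∈ C_z(red)} ∩ {A′ meets neither C_z(red) nor C_z(blue)}` is nonnegative at every monotone pair:
  `0 ≤ Σ_{s : z ∉ C_x(s), z ∉ C_x(sᶜ), a ∈ C_z(s), A′ ∩ (C_z(s) ∪ C_z(sᶜ)) = ∅} (f(C_x s) − f(C_x sᶜ))·(g(C_x s) − g(C_x sᶜ))`.
Proof: only `e₀ ∈ s` contributes (`a ≠ z`); then `C_z(s) = {z} ∪ C_v(s ∖ e₀)`, `C_z(sᶜ) = {z}`, `z ∉ C_x(s) ⟺ v ∉ C_x(s ∖ e₀)`, and the sum is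
`offCluster_twoColouring_nonneg_pred_sub` on `E ∖ e₀` with `A = {v}`, `P(R) = (a ∈ R ∧ A′ ∩ R = ∅)`.  [cite: KozmaNitzan2024, Questions 8–9 (§5.5 p. 36) (context)] -/
theorem rz_pendant (ends : ι → Sym2 V) {z v x : V} {e₀ : ι} (he₀ : ends e₀ = s(z, v))
    (hpend : ∀ i, z ∈ ends i → i = e₀) (hzx : z ≠ x) (hzv : z ≠ v) {a : V} (haz : a ≠ z) (A' : Set V) (hzA : z ∉ A')
    (f g : Set V → ℝ) (hf : Monotone f) (hg : Monotone g) :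
    0 ≤ ∑ s ∈ univ.filter (fun s : Finset ι =>
        z ∉ openCluster (ends '' (↑s : Set ι)) x ∧ z ∉ openCluster (ends '' (↑(sᶜ) : Set ι)) x ∧
          a ∈ openCluster (ends '' (↑s : Set ι)) z ∧
          ∀ a' ∈ A', a' ∉ openCluster (ends '' (↑s : Set ι)) z ∧ a' ∉ openCluster (ends '' (↑(sᶜ) : Set ι)) z),
      (f (openCluster (ends '' (↑s : Set ι)) x) - f (openCluster (ends '' (↑(sᶜ) : Set ι)) x)) *
        (g (openCluster (ends '' (↑s : Set ι)) x) - g (openCluster (ends '' (↑(sᶜ) : Set ι)) x)) := by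
  set K : Finset ι → Set V := fun s => openCluster (ends '' (↑s : Set ι)) x with hK
  set Cz : Finset ι → Set V := fun s => openCluster (ends '' (↑s : Set ι)) z with hCz
  set Cv : Finset ι → Set V := fun s => openCluster (ends '' (↑s : Set ι)) v with hCv
  set E' : Finset ι := univ.erase e₀ with hE'
  set Φ' : Finset ι → ℝ := fun t => (f (K t) - f (K (E' \ t))) * (g (K t) - g (K (E' \ t))) with hΦ'
  change 0 ≤ ∑ s ∈ univ.filter (fun s : Finset ι => z ∉ K s ∧ z ∉ K sᶜ ∧ a ∈ Cz s ∧ ∀ a' ∈ A', a' ∉ Cz s ∧ a' ∉ Cz sᶜ),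
    (f (K s) - f (K sᶜ)) * (g (K s) - g (K sᶜ))
  have he₀E' : e₀ ∉ E' := fun h => (Finset.mem_erase.mp h).1 rfl
  have huniv : (univ : Finset (Finset ι)) = (insert e₀ E').powerset := by
    rw [hE', Finset.insert_erase (Finset.mem_univ e₀), Finset.powerset_univ]
  -- the predicate off-cluster sum on `G − e₀`
  have hbase : 0 ≤ ∑ t ∈ E'.powerset.filter (fun t : Finset ι => v ∉ K t ∧ (a ∈ Cv t ∧ ∀ a' ∈ A', a' ∉ Cv t)), Φ' t := by
    have := offCluster_twoColouring_nonneg_pred_sub ends E' x ({v} : Set V)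
      (fun R : Set V => a ∈ R ∧ ∀ a' ∈ A', a' ∉ R) f g hf hg
    have hset : ∀ t : Finset ι, {y | ∃ b ∈ ({v} : Set V), y ∈ openCluster (ends '' (↑t : Set ι)) b} = Cv t := by
      intro t; ext y; simp [hCv]
    simpa [hK, hΦ', hset] using this
  have compl_of_sub : ∀ t, t ⊆ E' → tᶜ = insert e₀ (E' \ t) := by
    intro t ht
    ext i
    simp only [Finset.mem_compl, Finset.mem_insert, Finset.mem_sdiff, hE', Finset.mem_erase, Finset.mem_univ, and_true]
    constructor
    · intro hi
      by_cases hie : i = e₀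
      · exact Or.inl hie
      · exact Or.inr ⟨hie, hi⟩
    · rintro (rfl | ⟨_, hi⟩)
      · exact fun h => he₀E' (ht h)
      · exact hi
  have compl_insert_of_sub : ∀ t, t ⊆ E' → (insert e₀ t)ᶜ = E' \ t := by
    intro t ht
    ext i
    simp only [Finset.mem_compl, Finset.mem_insert, Finset.mem_sdiff, hE', Finset.mem_erase, Finset.mem_univ, and_true, not_or]
  have notin_of_sub : ∀ t, t ⊆ E' → e₀ ∉ t := fun t ht h => he₀E' (ht h)
  have notin_sdiff : ∀ t, e₀ ∉ E' \ t := fun t h => he₀E' (Finset.mem_sdiff.mp h).1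
  rw [Finset.sum_filter, huniv, Finset.sum_powerset_insert he₀E']
  -- first half: `e₀` blue, `C_z(t) = {z}` so `a ∉ C_z(t)`: every term vanishes
  have h1 : ∑ t ∈ E'.powerset, (if z ∉ K t ∧ z ∉ K tᶜ ∧ a ∈ Cz t ∧ ∀ a' ∈ A', a' ∉ Cz t ∧ a' ∉ Cz tᶜ then
      (f (K t) - f (K tᶜ)) * (g (K t) - g (K tᶜ)) else 0) = 0 := by
    refine Finset.sum_eq_zero fun t ht => ?_
    have hsub : t ⊆ E' := Finset.mem_powerset.mp ht
    have ha : a ∉ Cz t := fun h => haz ((mem_openCluster_leaf_iff_eq ends hpend (notin_of_sub t hsub) a).mp h)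
    simp [ha]
  -- second half: `e₀` red
  have h2 : ∑ t ∈ E'.powerset, (if z ∉ K (insert e₀ t) ∧ z ∉ K (insert e₀ t)ᶜ ∧ a ∈ Cz (insert e₀ t) ∧
        ∀ a' ∈ A', a' ∉ Cz (insert e₀ t) ∧ a' ∉ Cz (insert e₀ t)ᶜ then
        (f (K (insert e₀ t)) - f (K (insert e₀ t)ᶜ)) * (g (K (insert e₀ t)) - g (K (insert e₀ t)ᶜ)) else 0) =
      ∑ t ∈ E'.powerset, (if v ∉ K t ∧ (a ∈ Cv t ∧ ∀ a' ∈ A', a' ∉ Cv t) then Φ' t else 0) := by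
    refine Finset.sum_congr rfl fun t ht => ?_
    have hsub : t ⊆ E' := Finset.mem_powerset.mp ht
    have ht0 : e₀ ∉ t := notin_of_sub t hsub
    rw [compl_insert_of_sub t hsub]
    have hzc : z ∉ K (E' \ t) := leaf_not_mem_openCluster ends hpend hzx (notin_sdiff t)
    have hCz1 : ∀ y, y ∈ Cz (insert e₀ t) ↔ y = z ∨ y ∈ Cv t := fun y =>
      mem_openCluster_leaf_insert_iff ends he₀ hpend ht0 y
    have hCz2 : ∀ y, y ∈ Cz (E' \ t) ↔ y = z := fun y => mem_openCluster_leaf_iff_eq ends hpend (notin_sdiff t) y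
    have ha1 : a ∈ Cz (insert e₀ t) ↔ a ∈ Cv t := by rw [hCz1]; simp [haz]
    have hA1 : (∀ a' ∈ A', a' ∉ Cz (insert e₀ t) ∧ a' ∉ Cz (E' \ t)) ↔ (∀ a' ∈ A', a' ∉ Cv t) := by
      refine forall₂_congr fun a' ha' => ?_
      have ha'z : a' ≠ z := fun h => hzA (h ▸ ha')
      rw [hCz1, hCz2]; simp [ha'z]
    by_cases hv : v ∈ K t
    · have hz : z ∈ K (insert e₀ t) := (leaf_mem_openCluster_insert_iff ends he₀ hpend hzx hzv ht0).mpr hv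
      simp [hz, hv]
    · have hKi : K (insert e₀ t) = K t := openCluster_insert_pendant ends he₀ hpend hzx ht0 hv
      have hzt : z ∉ K t := leaf_not_mem_openCluster ends hpend hzx ht0
      rw [hKi, ha1, hA1]
      simp [hzt, hzc, hv, hΦ']
  rw [h1, h2, zero_add, ← Finset.sum_filter]
  exact hbase

end pendant

end Coefficientwise

end Summit.CriticalPhenomena.PercolationContinuityZ3.Theorems
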